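import Literature.AlgebraicGeometry.Motives.GAGAKaehlerImmersionProofs
import Literature.AlgebraicGeometry.HodgeTheory.HypersurfaceLefschetzProofs
import HarnessLib

/-!
# Linear sections in affine coordinates: `ι(Q) ∈ V₊(ℓᵢ)ᵢ` iff `ℓᵢ(ι^*(x/xⱼ)(Q)) = 0`

Family `hodge`, layer `Literature/AlgebraicGeometry/HodgeTheory`. For a morphism `ι : X ⟶ ℙᴺ_k` the
file `GAGAKaehlerImmersionProofs` (Part A) reads `ι` on the chart `ι⁻¹D₊(xⱼ)` through the ratios
`ι^*(xᵢ/xⱼ) ∈ Γ(X, ι⁻¹D₊(xⱼ))` (`GeneratingSections.affineChartData ι`, Hartshorne II Thm. 7.1), and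
`HypersurfaceLefschetzProofs` cuts `ℙᴺ_ℂ` by linear subspaces `V₊(ℓ_{A 0}, …, ℓ_{A m})`
(`linearSubspace N A`). This file links the two: **a point `Q` of the chart `ι⁻¹D₊(xⱼ)` maps into
`V₊(ℓ_{A i})ᵢ` iff all the linear forms vanish on its affine coordinates `(ι^*(xᵢ/xⱼ)(Q))ᵢ`** — i.e.
iff the row map `linMapOfRows A` kills the coordinate vector (`pt_notMem_preimage_linearSubspace_iff`).
Ingredients, ALL PROVED:

* `GeneratingSections.basicOpen_topIso_hom_pull_isLocalizationElem` — for `g` homogeneous of degree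
  `m > 0`, the section `ι^*(g/xⱼᵐ) ∈ Γ(X, ι⁻¹D₊(xⱼ))` has non-vanishing locus
  `ι⁻¹D₊(xⱼ) ∩ ι⁻¹D₊(g)` (Mathlib `Proj.awayι_preimage_basicOpen`; the case `g = x_l` is the tree's
  `basicOpen_homRatio`);
* `GeneratingSections.topIso_hom_pull_isLocalizationElem_eq_eval₂` — for `g` linear,
  `ι^*(g/xⱼ) = g(ι^*(x₀/xⱼ), …, ι^*(x_N/xⱼ))` (dehomogenisation, `awayMk_eq_eval₂`);
* `eval_topIso_hom_pull_isLocalizationElem` — hence its value at an `L`-point `Q` of the chart is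
  `g((ι^*(xᵢ/xⱼ)(Q))ᵢ)` (evaluation is a ring homomorphism; the chart constants are the structure
  constants, `topIso_hom_pull_chartLift_cst`, `eval_res_pull_toSpec`);
* `base_pt_mem_basicOpen_iff_eval_ne_zero`, `pt_notMem_preimage_linearSubspace_iff` — the
  membership statements (Hartshorne II Prop. 2.5: `x ∈ D₊(g) ⟺ g ∉ 𝔭_x`).

Consumer: the support of `ch_p(𝒪(-1)|_{X^an})` on a codimension-`p` linear section
(`HolomorphicBundleChernCharacter*`): on the analytification, `m ↦ T(Gⱼ(m))` (`T = linMapOfRows A`,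
`Gⱼ` the affine coordinates) vanishes exactly over `ι⁻¹V₊(ℓ_{A i})ᵢ`.

## References

* R. Hartshorne, *Algebraic Geometry* (1977), II Prop. 2.5, II Thm. 7.1. [Hartshorne1977]
* A. Grothendieck, *Hodge's general conjecture is false for trivial reasons*, Topology 8 (1969), §1.
  [GrothendieckTopology1969]
-/

universe u

open CategoryTheory AlgebraicGeometry Limits HomogeneousLocalization TopologicalSpace Opposite
open MvPolynomial (X C eval₂Hom)
open Literature.AlgebraicGeometry.Motives.Segre

attribute [local instance] MvPolynomial.gradedAlgebra

noncomputable section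

/-! ## Part A. Sections `ι^*(g/xⱼᵐ)` on the chart `ι⁻¹D₊(xⱼ)` -/

namespace Literature.AlgebraicGeometry.Motives

namespace GeneratingSections

section ChartLift

variable {ι : Type} {k : Type u} [CommRing k] {Y : Scheme.{u}} (r : Y ⟶ Proj (grading ι k))

/-- **The non-vanishing locus of `r^*(gᵈ/xⱼᵐ)` is `r⁻¹D₊(xⱼ) ∩ r⁻¹D₊(g)`** for `g` homogeneous of
degree `m > 0` (Mathlib `Proj.awayι_preimage_basicOpen`: `D₊(xⱼ) ∩ D₊(g)` is the basic open of
`g/xⱼᵐ` in `D₊(xⱼ) = Spec (k[x]_{(xⱼ)})₀`; the case `g = x_l` is `basicOpen_homRatio`).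
[cite: Hartshorne1977, II Prop. 2.5] -/
theorem basicOpen_topIso_hom_pull_isLocalizationElem (j : ι) {m : ℕ} {g : MvPolynomial ι k}
    (hg : g ∈ grading ι k m) (hm : 0 < m) :
    Y.basicOpen ((preU r j).topIso.hom (pull (chartLift r j) (Away.isLocalizationElem (X_mem k j) hg))) =
      preU r j ⊓ r ⁻¹ᵁ Proj.basicOpen (grading ι k) g := by
  have h1 : Y.basicOpen ((preU r j).topIso.hom
        (pull (chartLift r j) (Away.isLocalizationElem (X_mem k j) hg))) =
      (preU r j).ι ''ᵁ (preU r j : Scheme.{u}).basicOpen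
        (pull (chartLift r j) (Away.isLocalizationElem (X_mem k j) hg)) := by
    rw [← Scheme.Opens.ι_image_basicOpen_topIso_inv, ← CommRingCat.comp_apply, Iso.hom_inv_id]
    rfl
  rw [h1, basicOpen_pull, ← Proj.awayι_preimage_basicOpen _ (X_mem k j) zero_lt_one hg hm,
    ← Scheme.Hom.comp_preimage, chartLift_chartι, Scheme.Hom.comp_preimage,
    Scheme.Hom.image_preimage_eq_opensRange_inf, Scheme.Opens.opensRange_ι]

/-- **Dehomogenisation of a linear form on the chart**: for `g` homogeneous of degree `1`,
`r^*(g/xⱼ) = g(r^*(x₀/xⱼ), …)` as a polynomial in the ratios with the chart constants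
(`awayMk_eq_eval₂`: `g/xⱼ = g(xᵢ/xⱼ)` in `(k[x]_{(xⱼ)})₀`). [cite: Hartshorne1977, II Prop. 2.5 (proof)] -/
theorem topIso_hom_pull_isLocalizationElem_eq_eval₂ (j : ι) {g : MvPolynomial ι k}
    (hg : g ∈ grading ι k 1) :
    (preU r j).topIso.hom (pull (chartLift r j) (Away.isLocalizationElem (X_mem k j) hg)) =
      MvPolynomial.eval₂
        ((preU r j).topIso.hom.hom.comp ((pull (chartLift r j)).comp (cst k (X j))))
        (fun i ↦ homRatio r j i) g := by
  have h : Away.isLocalizationElem (X_mem k j) hg = eval₂Hom (cst k (X j)) (frac k j) g := by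
    rw [Away.isLocalizationElem, awayMk_eq_eval₂, map_pow, pow_one]
  rw [h, ← RingHom.comp_apply, ← RingHom.comp_apply, ← RingHom.comp_assoc, MvPolynomial.comp_eval₂Hom,
    MvPolynomial.coe_eval₂Hom]
  rfl

end ChartLift

/-! ## Part B. Values at `L`-points -/

section Points

variable {k : Type} [Field k] {X : SchemeOver k} {L : Type} [Field L] [Algebra k L]
  {N : ℕ} (ι : X ⟶ projectiveSpace N k)

/-- **The value of `ι^*(g/xⱼ)` at an `L`-point `Q` of the chart is `g((ι^*(xᵢ/xⱼ)(Q))ᵢ)`** (with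
the coefficients of `g` mapped along `k → L`): evaluation at `Q` is a ring homomorphism and the chart
constants evaluate to the structure constants. [cite: Hartshorne1977, II Thm. 7.1] -/
theorem eval_topIso_hom_pull_isLocalizationElem (j : Fin (N + 1)) {g : MvPolynomial (Fin (N + 1)) k}
    (hg : g ∈ grading (Fin (N + 1)) k 1) (Q : AlgPoints X L) (h : Q.pt ∈ preU ι.left j) :
    Q.eval (preU ι.left j) h ((preU ι.left j).topIso.hom
        (pull (chartLift ι.left j) (Away.isLocalizationElem (X_mem k j) hg))) =
      MvPolynomial.eval₂ (algebraMap k L) (fun i ↦ Q.eval (preU ι.left j) h (homRatio ι.left j i)) g := by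
  rw [topIso_hom_pull_isLocalizationElem_eq_eval₂, ← AlgPoints.evalRingHom_apply]
  refine (MvPolynomial.eval₂_comp_left (Q.evalRingHom (preU ι.left j) h) _ _ g).trans ?_
  congr 1
  ext c
  simp only [RingHom.comp_apply]
  change Q.eval _ h ((preU ι.left j).topIso.hom (pull (chartLift ι.left j) (cst k (MvPolynomial.X j) c))) = _
  rw [topIso_hom_pull_chartLift_cst]
  exact eval_res_pull_toSpec ι Q h c

end Points

end GeneratingSections

end Literature.AlgebraicGeometry.Motives

/-! ## Part C. Membership in `D₊(g)` and in linear subspaces, over `ℂ` -/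

namespace Literature.AlgebraicGeometry.HodgeTheory

open Literature.AlgebraicGeometry.Motives Literature.AlgebraicGeometry.Motives.GeneratingSections

section Membership

variable {N : ℕ} {X : Motives.SchemeOver ℂ} (ι : X ⟶ Motives.projectiveSpace N ℂ)

/-- The grading of `ℂ[x₀, …, x_N]` by degree (`ℙᴺ_ℂ = Proj 𝓐`). -/
local notation "𝓐" => MvPolynomial.homogeneousSubmodule (Fin (N + 1)) ℂ

/-- **`ι(Q) ∈ D₊(g)` iff `g` does not vanish on the affine coordinates of `Q`**, for `g` linear and
`Q` a complex point of the chart `ι⁻¹D₊(xⱼ)` (`Q ∈ X_{ι^*(g/xⱼ)} ⟺ ι^*(g/xⱼ)(Q) ≠ 0`,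
`AlgPoints.pt_mem_basicOpen_iff`, with Parts A and B). [cite: Hartshorne1977, II Prop. 2.5] -/
theorem base_pt_mem_basicOpen_iff_eval_ne_zero (j : Fin (N + 1)) {g : MvPolynomial (Fin (N + 1)) ℂ}
    (hg : g ∈ 𝓐 1) (Q : Motives.ComplexPoints X) (h : Q.pt ∈ (affineChartData ι).U j) :
    ι.left.base Q.pt ∈ Proj.basicOpen 𝓐 g ↔
      MvPolynomial.eval (fun i ↦ Q.eval _ h ((affineChartData ι).ratio j i)) g ≠ 0 := by
  have h' : Q.pt ∈ preU ι.left j := h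
  have key := Q.pt_mem_basicOpen_iff h' ((preU ι.left j).topIso.hom
    (pull (chartLift ι.left j) (Away.isLocalizationElem (X_mem ℂ j) hg)))
  rw [basicOpen_topIso_hom_pull_isLocalizationElem ι.left j hg one_pos,
    eval_topIso_hom_pull_isLocalizationElem ι j hg Q h', Algebra.algebraMap_self,
    MvPolynomial.eval₂_id] at key
  change _ ↔ MvPolynomial.eval (fun i ↦ Q.eval (preU ι.left j) h' (homRatio ι.left j i)) g ≠ 0
  rw [← key]
  exact ⟨fun hm ↦ ⟨h', hm⟩, fun hm ↦ hm.2⟩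

/-- **A chart point maps into the linear subspace `V₊(ℓ_{A i})ᵢ` iff the row map kills its affine
coordinates**: for `Q` a complex point of `ι⁻¹D₊(xⱼ)`,
`ι(Q) ∉ V₊(ℓ_{A 0}, …, ℓ_{A m}) ⟺ (ℓ_{A i}(ι^*(x/xⱼ)(Q)))ᵢ ≠ 0` (`x ∈ V₊(g) ⟺ g ∈ 𝔭_x ⟺ x ∉ D₊(g)`).
[cite: Hartshorne1977, II Prop. 2.5] -/
theorem pt_notMem_preimage_linearSubspace_iff {m : ℕ} (A : Fin (m + 1) → Fin (N + 1) → ℂ)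
    (j : Fin (N + 1)) (Q : Motives.ComplexPoints X) (h : Q.pt ∈ (affineChartData ι).U j) :
    Q.pt ∉ ι.left.base ⁻¹' linearSubspace N A ↔
      linMapOfRows A (fun i ↦ Q.eval _ h ((affineChartData ι).ratio j i)) ≠ 0 := by
  rw [Set.mem_preimage, mem_linearSubspace_iff, not_forall, Function.ne_iff]
  refine exists_congr fun i ↦ ?_
  refine ((Proj.mem_basicOpen 𝓐 (linForm N (A i)) _).symm.trans
    (base_pt_mem_basicOpen_iff_eval_ne_zero ι j (linForm_mem N (A i)) Q h)).trans ?_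
  rw [eval_linForm, linMapOfRows_apply]
  exact Iff.rfl

end Membership

end Literature.AlgebraicGeometry.HodgeTheory

end
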